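import Literature.MathematicalPhysics.QuantumManyBody.LiebSimpleEquationErratum
import HarnessLib

/-!
# Lieb's simple equation: square-well density bounds; CJL-II Theorem 3 as printed is false

Topic: `Literature/MathematicalPhysics/QuantumManyBody`. Everything in this file is proved; it
completes the erratum evidence of `LiebSimpleEquationErratum.lean` against CJL-II Theorem 3 AS
PRINTED (CJL-II = Carlen–Jauslin–Lieb, SIAM J. Math. Anal. 53 (2021), arXiv:2010.13882, Theorem 3
of the arXiv version: monotonicity of `ρ(e)` for `e < e⋆ = √2π³/‖v‖₁²` and `e > 2³‖v‖₂⁴/π⁴`, `C¹`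
there, and `ρ′ ≤ 16/‖v‖₁` for `e < e⋆`; formerly vendored verbatim as the named fact
`CarlenJauslinLieb2021_thm3` of `LiebSimpleEquationFacts.lean`, which was retired from the fact
list once refuted — a false `Prop` must not be offered as a hypothesis — so that the printed
statement now lives verbatim in the TYPES of the refuting theorems). There the refutation was
conditional on CJL-I Theorems 1–2 (`not_CarlenJauslinLieb2021_thm3 : thm1 → thm2 → ¬ (printed)`);
here it is **unconditional** (`not_CarlenJauslinLieb2021_thm3_unconditional : ¬ (printed)`, the
same explicit statement): the two uses of CJL-I are replaced by two elementary a priori bounds for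
solutions of the simple equation with the square well `v = V₀·𝟙_{|x|<R}`, both obtained from the
mild form
`u = Y_{4e} ∗ ((1 − u)v + 2eρ u∗u)` (CJL-I (1.10)), `0 ≤ u ≤ 1`, `∫Y_{4e} = (4e)⁻¹` and
`∫u = 1/ρ` (CJL-I (1.6); `LiebSimpleEquationProofs.lean`).

## What is proved here

* `IsSolution.integral_one_sub_mul_exp_le`, `IsSolution.two_mul_energy_mul_exp_le` — **lower
  bound**: for `0 ≤ v ≤ V₀` vanishing off `|x| < R`, every solution at `e > 0` has
  `Q·e^{−2√eR} ≤ 4πR`, `Q = ∫(1 − u)v = 2e/ρ`, i.e. `2e·e^{−2√eR} ≤ 4πR·ρ` (evaluate the equation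
  at the origin, drop `2eρY_{4e}∗(u∗u) ≥ 0`, `Y_{4e} ≥ e^{−2√eR}/(4πR)` on the support, `u(0) ≤ 1`).
  This is the one-sided elementary form of the Lee–Huang–Yang leading order `ρ(e) ∼ e/(2πa)`
  with the scattering length `a` replaced by `R ≥ a`.
* `IsSolution.le_conv_add_half` — `u ≤ Y_{4e} ∗ ((1 − u)v) + ½` (`u∗u ≤ ∫u = 1/ρ`).
* `IsSolution.density_mul_le_of_squareWell` — **upper bound**: for `v = V₀·𝟙_{|x|<R}`, `V₀ > 0`,
  every solution at `e > 0` has `ρ·V₀|B_R| ≤ 4e(1 + V₀M₀)`, `M₀ = ∫_{|t|<2R} Y_0` (on `B_R`,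
  `1 − u ≥ ½ − (𝟙_{2R}Y_0) ∗ ((1 − u)v)`; integrate over `B_R`, Fubini `∫(𝟙_{2R}Y_0) ∗ g = M₀∫g`,
  `∫(1 − u)v = V₀∫_{B_R}(1 − u)`). In particular solution densities are `O(e)` as `e → 0⁺`.
* `isWeightedPotential_indicator_ball` — the square well is a CJL-II potential.
* `densityFn_nonneg`, `densityFn_le_of_forall_le`, `exists_isSolution_of_densityFn_pos`,
  `le_densityFn_of_isSolution` — bookkeeping for the tree's rendering
  `densityFn v e = sSup (solutionDensities v e)` (junk value `0`).
* `densityFn_le_mul_of_deriv_le'` — `ρ` continuous and differentiable on `(0,E)`, `ρ′ ≤ C`,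
  `ρ(0⁺) = 0` give `ρ(e) ≤ Ce` (mean value inequality).
* **`not_CarlenJauslinLieb2021_thm3_unconditional`: CJL-II Theorem 3 as printed is false.** For
  `v = 30·𝟙_{|x|<1}` (`‖v‖₁ = 40π`, `e⋆ = √2π/1600 ≤ 1/200`): Theorem 3 would give, on `(0,e⋆)`,
  `ρ(e) > 0` (strict monotonicity and `ρ ≥ 0`), hence a solution at every such `e` with density
  `≤ ρ(e)`; `ρ(0⁺) = 0` (upper bound) and `ρ ∈ C¹`, `ρ′ ≤ 16/‖v‖₁` give `ρ(e) ≤ 2e/(5π)`; the lower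
  bound at `e₀ = e⋆/2 < 1/100` then reads `2e₀(1 − 2√e₀) ≤ (8/5)e₀`, i.e. `2√e₀ ≥ 1/5`, absurd.

Which conjunct of the printed theorem fails, and why, is discussed in
`LiebSimpleEquationErratum.lean` and in the `## Erratum` section of `LiebSimpleEquationFacts.lean`:
the clause `ρ′ ≤ 16/‖v‖₁` (with `ρ(0⁺) = 0`) caps `ρ(e)/e` by `16/‖v‖₁`, whereas for a strong
short-range potential `ρ(e)/e → 1/(2πa) ≫ 16/‖v‖₁`; the printed proof imports the false upper
half `ρ ≤ 4e/‖v‖₁` of "(1.21) of [CJL20]".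

## References

* [CarlenJauslinLieb2021] E. A. Carlen, I. Jauslin, E. H. Lieb, *Analysis of a simple equation for
  the ground state of the Bose gas II: monotonicity, convexity, and condensate fraction*, SIAM J.
  Math. Anal. 53 (2021) 5322–5360, arXiv:2010.13882 (arXiv numbering): Theorem 3 and its proof
  (§3).
* [CarlenJauslinLieb2020] E. A. Carlen, I. Jauslin, E. H. Lieb, *Analysis of a simple equation for
  the ground state energy of the Bose gas*, Pure Appl. Anal. 2 (2020) 659–684, arXiv:1912.04987:
  (1.2), (1.6), (1.8)–(1.10), §1 (the display "(1.21)").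
-/

noncomputable section

open MeasureTheory Filter Set Metric
open scoped ENNReal Topology

namespace Literature.MathematicalPhysics.QuantumManyBody

namespace LiebSimpleEquation

open BoseGas (Space)

/-! ## Elementary facts about solutions -/

/-- For `0 ≤ u ≤ 1` integrable, `0 ≤ u∗u(y) ≤ ∫u` pointwise. [folklore] -/
theorem conv_self_le_integral {u : Space → ℝ} (hi : Integrable u) (h0 : ∀ x, 0 ≤ u x)
    (h1 : ∀ x, u x ≤ 1) (y : Space) : 0 ≤ conv u u y ∧ conv u u y ≤ ∫ x, u x := by
  rw [conv_apply]
  refine ⟨integral_nonneg fun z => mul_nonneg (h0 z) (h0 _), ?_⟩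
  have hint : Integrable (fun z => u z * u (y - z)) := by
    refine hi.mul_bdd (c := 1) (hi.comp_sub_left y).aestronglyMeasurable
      (Eventually.of_forall fun z => ?_)
    rw [Real.norm_of_nonneg (h0 _)]
    exact h1 _
  refine integral_mono hint hi fun z => ?_
  have := h0 z
  have := h1 (y - z)
  show u z * u (y - z) ≤ u z
  nlinarith

/-! ## Potentials supported in a ball: evaluating the equation at the origin -/

/-- **`Q·e^{−√c R} ≤ 4πR`, `Q = ∫(1 − u)v`, for a solution with a bounded non-negative potential
supported in `|x| < R`** (`c = 4e`): evaluate the mild equation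
`u = Y_{4e} ∗ ((1 − u)v + 2eρ u∗u)` at the origin, drop the non-negative term `2eρ Y_{4e}∗(u∗u)`,
bound `Y_{4e}(y) ≥ e^{−2√e R}/(4πR)` on the support of `v(−·)`, and use `u(0) ≤ 1`. This is the
elementary one-sided form of the leading Lee–Huang–Yang asymptotics `ρ(e) ∼ e/(2πa)` with the
scattering length `a` replaced by the radius `R ≥ a` of the support. [folklore] -/
theorem IsSolution.integral_one_sub_mul_exp_le {v : Space → ℝ} {ρ e : ℝ} {u : Space → ℝ}
    (hu : IsSolution v ρ e u) {R V₀ : ℝ} (hR : 0 < R) (hv0 : ∀ x, 0 ≤ v x)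
    (hvb : ∀ x, v x ≤ V₀) (hvR : ∀ x, R ≤ ‖x‖ → v x = 0) (hvi : Integrable v) (he : 0 < e) :
    (∫ x, (1 - u x) * v x) * Real.exp (-(Real.sqrt (4 * e) * R)) ≤ 4 * Real.pi * R := by
  have hρ : 0 < ρ := hu.density_pos hv0 he
  set g : Space → ℝ := fun x => (1 - u x) * v x with hg
  have hV : 0 ≤ V₀ := (hv0 0).trans (hvb 0)
  have hg0 : ∀ x, 0 ≤ g x := fun x => mul_nonneg (sub_nonneg.2 (hu.le_one x)) (hv0 x)
  have hgb : ∀ x, g x ≤ V₀ := fun x => by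
    have h1 : 1 - u x ≤ 1 := by linarith [hu.nonneg x]
    calc g x = (1 - u x) * v x := rfl
      _ ≤ 1 * V₀ := mul_le_mul h1 (hvb x) (hv0 x) zero_le_one
      _ = V₀ := one_mul _
  have hgR : ∀ x, R ≤ ‖x‖ → g x = 0 := fun x hx => by simp [hg, hvR x hx]
  have hgi : Integrable g := hu.integrable_one_sub_mul hvi
  -- the convolution square
  obtain ⟨huu, -⟩ := integral_conv_self hu.integrable
  have hIu : ∫ x, u x = 1 / ρ := hu.integral_eq hvi hρ he
  have huu0 : ∀ y, 0 ≤ conv u u y := fun y =>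
    (conv_self_le_integral hu.integrable hu.nonneg hu.le_one y).1
  have huu1 : ∀ y, conv u u y ≤ 1 / ρ := fun y =>
    hIu ▸ (conv_self_le_integral hu.integrable hu.nonneg hu.le_one y).2
  -- the source term `F = g + 2eρ u∗u ≥ g ≥ 0`
  set F : Space → ℝ := fun y => (1 - u y) * v y + 2 * e * ρ * conv u u y with hF
  have hFg : ∀ y, g y ≤ F y := fun y => by
    have : 0 ≤ 2 * e * ρ * conv u u y := mul_nonneg (by positivity) (huu0 y)
    show (1 - u y) * v y ≤ (1 - u y) * v y + 2 * e * ρ * conv u u y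
    linarith
  have hF0 : ∀ y, 0 ≤ F y := fun y => (hg0 y).trans (hFg y)
  have hFb : ∀ y, F y ≤ V₀ + 2 * e := fun y => by
    have h1 : 2 * e * ρ * conv u u y ≤ 2 * e * ρ * (1 / ρ) :=
      mul_le_mul_of_nonneg_left (huu1 y) (by positivity)
    have h2 : 2 * e * ρ * (1 / ρ) = 2 * e := by field_simp
    show (1 - u y) * v y + 2 * e * ρ * conv u u y ≤ V₀ + 2 * e
    linarith [hgb y]
  have hFi : Integrable F := hgi.add (huu.const_mul (2 * e * ρ))
  -- the equation at the origin
  have h4e : 0 < 4 * e := by positivity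
  have hY : Integrable (yukawa (4 * e)) := integrable_yukawa h4e
  have h0 : u 0 = ∫ t, yukawa (4 * e) t * F (0 - t) := by rw [hu.mild 0, conv_apply]
  have hYF : Integrable fun t => yukawa (4 * e) t * F (0 - t) := by
    refine hY.mul_bdd (c := V₀ + 2 * e) (hFi.comp_sub_left 0).aestronglyMeasurable
      (Eventually.of_forall fun t => ?_)
    rw [Real.norm_of_nonneg (hF0 _)]
    exact hFb _
  -- a.e. lower bound `m g(0 - t) ≤ Y t F(0 - t)` (it may fail only at `t = 0`)
  set m : ℝ := Real.exp (-(Real.sqrt (4 * e) * R)) / (4 * Real.pi * R) with hm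
  have hm0 : 0 < m := by positivity
  have hnull : ∀ᵐ t ∂(volume : Measure Space), t ≠ (0 : Space) := by
    rw [ae_iff]
    simp
  have hae : ∀ᵐ t ∂(volume : Measure Space), m * g (0 - t) ≤ yukawa (4 * e) t * F (0 - t) := by
    filter_upwards [hnull] with t ht
    by_cases htR : ‖t‖ < R
    · have hpos : 0 < ‖t‖ := norm_pos_iff.2 ht
      have hy : m ≤ yukawa (4 * e) t := by
        rw [hm]
        unfold yukawa
        have h1 : Real.exp (-(Real.sqrt (4 * e) * R)) ≤ Real.exp (-(Real.sqrt (4 * e) * ‖t‖)) :=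
          Real.exp_le_exp.2 (by nlinarith [Real.sqrt_nonneg (4 * e)])
        have h2 : 0 < 4 * Real.pi * ‖t‖ := by positivity
        calc Real.exp (-(Real.sqrt (4 * e) * R)) / (4 * Real.pi * R)
            ≤ Real.exp (-(Real.sqrt (4 * e) * R)) / (4 * Real.pi * ‖t‖) := by
              gcongr
          _ ≤ Real.exp (-(Real.sqrt (4 * e) * ‖t‖)) / (4 * Real.pi * ‖t‖) := by
              gcongr
      calc m * g (0 - t) ≤ yukawa (4 * e) t * g (0 - t) :=
            mul_le_mul_of_nonneg_right hy (hg0 _)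
        _ ≤ yukawa (4 * e) t * F (0 - t) :=
            mul_le_mul_of_nonneg_left (hFg _) (yukawa_nonneg _ t)
    · have h1 : g (0 - t) = 0 := hgR _ (by rw [zero_sub, norm_neg]; exact not_lt.1 htR)
      rw [h1, mul_zero]
      exact mul_nonneg (yukawa_nonneg _ t) (hF0 _)
  have hmono := integral_mono_ae ((hgi.comp_sub_left 0).const_mul m) hYF hae
  rw [integral_const_mul, integral_sub_left_eq_self g volume (0 : Space), ← h0] at hmono
  have hkey : m * ∫ t, g t ≤ 1 := hmono.trans (hu.le_one 0)
  have h4 : 0 < 4 * Real.pi * R := by positivity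
  calc (∫ x, g x) * Real.exp (-(Real.sqrt (4 * e) * R))
      = (4 * Real.pi * R) * (m * ∫ t, g t) := by
        rw [hm]; field_simp
    _ ≤ (4 * Real.pi * R) * 1 := by gcongr
    _ = 4 * Real.pi * R := mul_one _

/-- **Lower bound on the density**: `2e·e^{−2√e R} ≤ 4πR·ρ` for every solution at energy
`e > 0` with a bounded non-negative potential supported in `|x| < R` (`2e = ρ∫(1 − u)v` and
`integral_one_sub_mul_exp_le`); i.e. `ρ ≥ e^{1−2√eR}… ≥ e(1 − 2√e R)/(2πR)`. [folklore] -/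
theorem IsSolution.two_mul_energy_mul_exp_le {v : Space → ℝ} {ρ e : ℝ} {u : Space → ℝ}
    (hu : IsSolution v ρ e u) {R V₀ : ℝ} (hR : 0 < R) (hv0 : ∀ x, 0 ≤ v x)
    (hvb : ∀ x, v x ≤ V₀) (hvR : ∀ x, R ≤ ‖x‖ → v x = 0) (hvi : Integrable v) (he : 0 < e) :
    2 * e * Real.exp (-(Real.sqrt (4 * e) * R)) ≤ 4 * Real.pi * R * ρ := by
  have hρ : 0 < ρ := hu.density_pos hv0 he
  have hQ := hu.integral_one_sub_mul_exp_le hR hv0 hvb hvR hvi he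
  have hE : e = ρ / 2 * ∫ x, (1 - u x) * v x := hu.energy
  have h2e : 2 * e = ρ * ∫ x, (1 - u x) * v x := by rw [hE]; ring
  calc 2 * e * Real.exp (-(Real.sqrt (4 * e) * R))
      = ρ * ((∫ x, (1 - u x) * v x) * Real.exp (-(Real.sqrt (4 * e) * R))) := by rw [h2e]; ring
    _ ≤ ρ * (4 * Real.pi * R) := mul_le_mul_of_nonneg_left hQ hρ.le
    _ = 4 * Real.pi * R * ρ := by ring


/-! ## The square well: an a priori upper bound `ρ ≤ K e` -/

/-- `Y_c ≤ Y_0` pointwise for every `c` (`e^{−√c|x|} ≤ 1`).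
[cite: CarlenJauslinLieb2020, (1.8)–(1.9)] -/
theorem yukawa_le_yukawa_zero (c : ℝ) (t : Space) : yukawa c t ≤ yukawa 0 t := by
  unfold yukawa
  rw [Real.sqrt_zero, zero_mul, neg_zero, Real.exp_zero]
  exact div_le_div_of_nonneg_right
    (Real.exp_le_one_iff.2 (by nlinarith [Real.sqrt_nonneg c, norm_nonneg t])) (by positivity)

/-- **`u ≤ Y_{4e} ∗ ((1 − u)v) + ½`** for every solution at `e > 0` (non-negative bounded integrable
potential): in `u = Y_{4e} ∗ ((1 − u)v) + 2eρ Y_{4e} ∗ (u∗u)` one has `u∗u ≤ ∫u = 1/ρ`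
(CJL-I (1.6)) and `∫Y_{4e} = 1/(4e)`, so the second term is at most `2eρ · ρ⁻¹ · (4e)⁻¹ = ½`.
[folklore] -/
theorem IsSolution.le_conv_add_half {v : Space → ℝ} {ρ e : ℝ} {u : Space → ℝ}
    (hu : IsSolution v ρ e u) {V₀ : ℝ} (hv0 : ∀ x, 0 ≤ v x) (hvb : ∀ x, v x ≤ V₀)
    (hvi : Integrable v) (he : 0 < e) (x : Space) :
    u x ≤ conv (yukawa (4 * e)) (fun y => (1 - u y) * v y) x + 1 / 2 := by
  have hρ : 0 < ρ := hu.density_pos hv0 he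
  set g : Space → ℝ := fun y => (1 - u y) * v y with hg
  have hV : 0 ≤ V₀ := (hv0 0).trans (hvb 0)
  have hg0 : ∀ y, 0 ≤ g y := fun y => mul_nonneg (sub_nonneg.2 (hu.le_one y)) (hv0 y)
  have hgb : ∀ y, g y ≤ V₀ := fun y => by
    have h1 : 1 - u y ≤ 1 := by linarith [hu.nonneg y]
    calc g y = (1 - u y) * v y := rfl
      _ ≤ 1 * V₀ := mul_le_mul h1 (hvb y) (hv0 y) zero_le_one
      _ = V₀ := one_mul _
  have hgi : Integrable g := hu.integrable_one_sub_mul hvi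
  obtain ⟨huu, -⟩ := integral_conv_self hu.integrable
  have hIu : ∫ x, u x = 1 / ρ := hu.integral_eq hvi hρ he
  have huu0 : ∀ y, 0 ≤ conv u u y := fun y =>
    (conv_self_le_integral hu.integrable hu.nonneg hu.le_one y).1
  have huu1 : ∀ y, conv u u y ≤ 1 / ρ := fun y =>
    hIu ▸ (conv_self_le_integral hu.integrable hu.nonneg hu.le_one y).2
  have h4e : 0 < 4 * e := by positivity
  have hY : Integrable (yukawa (4 * e)) := integrable_yukawa h4e
  set F : Space → ℝ := fun y => (1 - u y) * v y + 2 * e * ρ * conv u u y with hF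
  have h0 : u x = ∫ t, yukawa (4 * e) t * F (x - t) := by rw [hu.mild x, conv_apply]
  have hA : Integrable fun t => yukawa (4 * e) t * g (x - t) := by
    refine hY.mul_bdd (c := V₀) (hgi.comp_sub_left x).aestronglyMeasurable
      (Eventually.of_forall fun t => ?_)
    rw [Real.norm_of_nonneg (hg0 _)]
    exact hgb _
  have hB : Integrable fun t => yukawa (4 * e) t * conv u u (x - t) := by
    refine hY.mul_bdd (c := 1 / ρ) (huu.comp_sub_left x).aestronglyMeasurable
      (Eventually.of_forall fun t => ?_)
    rw [Real.norm_of_nonneg (huu0 _)]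
    exact huu1 _
  have hfun : (fun t => yukawa (4 * e) t * F (x - t)) =
      fun t => yukawa (4 * e) t * g (x - t) +
        2 * e * ρ * (yukawa (4 * e) t * conv u u (x - t)) := by
    funext t
    simp only [hF, hg]
    ring
  have hsplit : u x = (∫ t, yukawa (4 * e) t * g (x - t)) +
      2 * e * ρ * ∫ t, yukawa (4 * e) t * conv u u (x - t) := by
    rw [h0, hfun, integral_add hA (hB.const_mul _), integral_const_mul]
  have hBle : ∫ t, yukawa (4 * e) t * conv u u (x - t) ≤ 1 / ρ * (1 / (4 * e)) := by
    calc ∫ t, yukawa (4 * e) t * conv u u (x - t) ≤ ∫ t, yukawa (4 * e) t * (1 / ρ) :=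
          integral_mono hB (hY.mul_const _) fun t =>
            mul_le_mul_of_nonneg_left (huu1 _) (yukawa_nonneg _ t)
      _ = 1 / ρ * (1 / (4 * e)) := by rw [integral_mul_const, integral_yukawa h4e]; ring
  have hhalf : 2 * e * ρ * ∫ t, yukawa (4 * e) t * conv u u (x - t) ≤ 1 / 2 := by
    calc 2 * e * ρ * ∫ t, yukawa (4 * e) t * conv u u (x - t)
        ≤ 2 * e * ρ * (1 / ρ * (1 / (4 * e))) := mul_le_mul_of_nonneg_left hBle (by positivity)
      _ = 1 / 2 := by field_simp; ring
  rw [conv_apply]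
  linarith

/-- For `g ≥ 0` vanishing off `|y| < R` and `|x| < R`: `(Y_c ∗ g)(x) ≤ ((𝟙_{|·|<2R} Y_0) ∗ g)(x)`
(`Y_c ≤ Y_0`, and `g(x − t) ≠ 0` forces `|t| < 2R`). [folklore] -/
theorem conv_yukawa_le_conv_indicator {g : Space → ℝ} {R c V₀ : ℝ} (hc : 0 < c)
    (hg0 : ∀ y, 0 ≤ g y) (hgb : ∀ y, g y ≤ V₀) (hgR : ∀ y, R ≤ ‖y‖ → g y = 0)
    (hgi : Integrable g) {x : Space} (hx : ‖x‖ < R) :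
    conv (yukawa c) g x ≤ conv ((ball (0 : Space) (2 * R)).indicator (yukawa 0)) g x := by
  rw [conv_apply, conv_apply]
  have hA : Integrable fun t => yukawa c t * g (x - t) := by
    refine (integrable_yukawa hc).mul_bdd (c := V₀) (hgi.comp_sub_left x).aestronglyMeasurable
      (Eventually.of_forall fun t => ?_)
    rw [Real.norm_of_nonneg (hg0 _)]
    exact hgb _
  have hH : Integrable fun t => (ball (0 : Space) (2 * R)).indicator (yukawa 0) t * g (x - t) := by
    refine (integrable_indicator_ball_yukawa_zero (2 * R)).mul_bdd (c := V₀)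
      (hgi.comp_sub_left x).aestronglyMeasurable (Eventually.of_forall fun t => ?_)
    rw [Real.norm_of_nonneg (hg0 _)]
    exact hgb _
  refine integral_mono hA hH fun t => ?_
  by_cases ht : R ≤ ‖x - t‖
  · show yukawa c t * g (x - t) ≤ (ball (0 : Space) (2 * R)).indicator (yukawa 0) t * g (x - t)
    rw [hgR _ ht, mul_zero, mul_zero]
  · have hxt : ‖x - t‖ < R := not_le.1 ht
    have ht2 : t ∈ ball (0 : Space) (2 * R) := by
      rw [mem_ball_zero_iff]
      calc ‖t‖ = ‖x - (x - t)‖ := by rw [sub_sub_cancel]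
        _ ≤ ‖x‖ + ‖x - t‖ := norm_sub_le _ _
        _ < R + R := add_lt_add hx hxt
        _ = 2 * R := by ring
    show yukawa c t * g (x - t) ≤ (ball (0 : Space) (2 * R)).indicator (yukawa 0) t * g (x - t)
    rw [indicator_of_mem ht2]
    exact mul_le_mul_of_nonneg_right (yukawa_le_yukawa_zero c t) (hg0 _)

/-- **A priori upper bound `ρ ≤ K·e` for the square well** `v = V₀·𝟙_{|x|<R}` (`V₀, R > 0`):
every solution at energy `e > 0` has `ρ · V₀|B_R| ≤ 4e(1 + V₀M₀)`, `M₀ := ∫_{|t|<2R} Y_0(t) dt`.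
Proof: by `le_conv_add_half` and `conv_yukawa_le_conv_indicator`, `1 − u ≥ ½ − (𝟙_{2R}Y_0) ∗ g` on
`B_R` (`g = (1 − u)v`); integrating over `B_R` and using `∫(𝟙_{2R}Y_0) ∗ g = M₀∫g` (Fubini)
gives `∫_{B_R}(1 − u) ≥ |B_R|/2 − M₀Q` with `Q = ∫g = V₀∫_{B_R}(1 − u)`, whence
`Q(1 + V₀M₀) ≥ V₀|B_R|/2`; finally `2e = ρQ`. In particular the solution densities at energy `e`
tend to `0` with `e`. [folklore] -/
theorem IsSolution.density_mul_le_of_squareWell {v : Space → ℝ} {ρ e : ℝ} {u : Space → ℝ}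
    (hu : IsSolution v ρ e u) {R V₀ : ℝ} (hV : 0 < V₀) (hv0 : ∀ x, 0 ≤ v x)
    (hvb : ∀ x, v x ≤ V₀) (hvR : ∀ x, R ≤ ‖x‖ → v x = 0) (hvin : ∀ x, ‖x‖ < R → v x = V₀)
    (hvi : Integrable v) (he : 0 < e) :
    ρ * (V₀ * (volume (ball (0 : Space) R)).toReal) ≤
      4 * e * (1 + V₀ * ∫ t, (ball (0 : Space) (2 * R)).indicator (yukawa 0) t) := by
  have hρ : 0 < ρ := hu.density_pos hv0 he
  set g : Space → ℝ := fun y => (1 - u y) * v y with hg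
  have hg0 : ∀ y, 0 ≤ g y := fun y => mul_nonneg (sub_nonneg.2 (hu.le_one y)) (hv0 y)
  have hgb : ∀ y, g y ≤ V₀ := fun y => by
    have h1 : 1 - u y ≤ 1 := by linarith [hu.nonneg y]
    calc g y = (1 - u y) * v y := rfl
      _ ≤ 1 * V₀ := mul_le_mul h1 (hvb y) (hv0 y) zero_le_one
      _ = V₀ := one_mul _
  have hgR : ∀ y, R ≤ ‖y‖ → g y = 0 := fun y hy => by simp [hg, hvR y hy]
  have hgi : Integrable g := hu.integrable_one_sub_mul hvi
  set Q : ℝ := ∫ y, g y with hQ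
  have h2e : 2 * e = ρ * Q := by
    have hE : e = ρ / 2 * ∫ x, (1 - u x) * v x := hu.energy
    rw [hE]; ring
  -- the comparison kernel `H = 𝟙_{|t|<2R} Y_0` and `G = H ∗ g`
  set H : Space → ℝ := (ball (0 : Space) (2 * R)).indicator (yukawa 0) with hH
  have hHi : Integrable H := integrable_indicator_ball_yukawa_zero (2 * R)
  have hH0 : ∀ t, 0 ≤ H t := fun t => indicator_nonneg (fun y _ => yukawa_nonneg 0 y) t
  set M₀ : ℝ := ∫ t, H t with hM₀
  have hM0 : 0 ≤ M₀ := integral_nonneg hH0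
  set G : Space → ℝ := conv H g with hG
  have hGi : Integrable G := hHi.integrable_convolution (ContinuousLinearMap.mul ℝ ℝ) hgi
  have hG0 : ∀ x, 0 ≤ G x := fun x => by
    rw [hG, conv_apply]
    exact integral_nonneg fun t => mul_nonneg (hH0 t) (hg0 _)
  have hIG : ∫ x, G x = M₀ * Q := by
    rw [hG, conv, integral_convolution (ContinuousLinearMap.mul ℝ ℝ) hHi hgi,
      ContinuousLinearMap.mul_apply']
  -- `½ − G ≤ 1 − u` on the ball
  have hpt : ∀ x ∈ ball (0 : Space) R, 1 / 2 - G x ≤ 1 - u x := by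
    intro x hx
    have hx' : ‖x‖ < R := mem_ball_zero_iff.1 hx
    have h1 := hu.le_conv_add_half hv0 hvb hvi he x
    have h2 := conv_yukawa_le_conv_indicator (c := 4 * e) (by positivity) hg0 hgb hgR hgi hx'
    change conv (yukawa (4 * e)) g x ≤ G x at h2
    change u x ≤ conv (yukawa (4 * e)) g x + 1 / 2 at h1
    linarith
  have hvol : volume (ball (0 : Space) R) ≠ ∞ := measure_ball_lt_top.ne
  have hf : IntegrableOn (fun x => 1 / 2 - G x) (ball (0 : Space) R) :=
    (integrableOn_const (C := (1 / 2 : ℝ)) hvol).sub hGi.integrableOn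
  have hg' : IntegrableOn (fun x => 1 - u x) (ball (0 : Space) R) :=
    (integrableOn_const (C := (1 : ℝ)) hvol).sub hu.integrable.integrableOn
  have hint := setIntegral_mono_on hf hg' measurableSet_ball hpt
  have hL : ∫ x in ball (0 : Space) R, (1 / 2 - G x) =
      1 / 2 * (volume (ball (0 : Space) R)).toReal - ∫ x in ball (0 : Space) R, G x := by
    rw [integral_sub (integrableOn_const (C := (1 / 2 : ℝ)) hvol) hGi.integrableOn,
      setIntegral_const, measureReal_def, smul_eq_mul, mul_comm]
  have hGB : ∫ x in ball (0 : Space) R, G x ≤ M₀ * Q :=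
    (setIntegral_le_integral hGi (Eventually.of_forall hG0)).trans hIG.le
  -- `Q = V₀ ∫_{B_R} (1 − u)`
  have hgind : g = (ball (0 : Space) R).indicator fun y => V₀ * (1 - u y) := by
    funext y
    by_cases hy : y ∈ ball (0 : Space) R
    · rw [indicator_of_mem hy, hg]
      show (1 - u y) * v y = V₀ * (1 - u y)
      rw [hvin y (mem_ball_zero_iff.1 hy), mul_comm]
    · rw [indicator_of_notMem hy]
      exact hgR y (not_lt.1 fun h => hy (mem_ball_zero_iff.2 h))
  have hQV : Q = V₀ * ∫ x in ball (0 : Space) R, (1 - u x) := by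
    rw [hQ, hgind, integral_indicator measurableSet_ball, integral_const_mul]
  -- combine
  have hkey : V₀ * (1 / 2 * (volume (ball (0 : Space) R)).toReal - M₀ * Q) ≤ Q := by
    rw [hQV] at hGB ⊢
    have := mul_le_mul_of_nonneg_left (hL.symm.le.trans hint) hV.le
    nlinarith [hGB, hV]
  have hQ1 : V₀ * (volume (ball (0 : Space) R)).toReal ≤ 2 * Q * (1 + V₀ * M₀) := by
    nlinarith [hkey]
  calc ρ * (V₀ * (volume (ball (0 : Space) R)).toReal) ≤ ρ * (2 * Q * (1 + V₀ * M₀)) :=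
        mul_le_mul_of_nonneg_left hQ1 hρ.le
    _ = 4 * e * (1 + V₀ * M₀) := by rw [show (4 : ℝ) * e = 2 * (2 * e) by ring, h2e]; ring


/-! ## The square well is a CJL-II potential -/

/-- The square well `V₀·𝟙_{|x|<R}` (`V₀ ≥ 0`) is a CJL-II potential: non-negative, radial,
`(1 + |x|⁴)v` bounded with compact support, hence in `L¹ ∩ L²`. [folklore] -/
theorem isWeightedPotential_indicator_ball (R : ℝ) {V₀ : ℝ} (hV : 0 ≤ V₀) :
    IsWeightedPotential ((ball (0 : Space) R).indicator fun _ => V₀) := by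
  set v : Space → ℝ := (ball (0 : Space) R).indicator fun _ => V₀ with hv
  have hmeas : MeasurableSet (ball (0 : Space) R) := measurableSet_ball
  have hv_nonneg : ∀ x, 0 ≤ v x := fun x => indicator_nonneg (fun _ _ => hV) x
  have hf_meas : AEStronglyMeasurable (fun x => (1 + ‖x‖ ^ 4) * v x) volume := by
    refine (Continuous.aestronglyMeasurable (by fun_prop)).mul ?_
    exact aestronglyMeasurable_const.indicator hmeas
  have hf_supp : HasCompactSupport (fun x => (1 + ‖x‖ ^ 4) * v x) := by
    refine HasCompactSupport.intro (isCompact_closedBall (0 : Space) |R|) fun x hx => ?_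
    have hx' : x ∉ ball (0 : Space) R := fun h => hx (by
      rw [mem_closedBall_zero_iff]
      exact ((mem_ball_zero_iff.1 h).trans_le (le_abs_self R)).le)
    simp [v, indicator_of_notMem hx']
  have hf_bound : ∀ x, ‖(1 + ‖x‖ ^ 4) * v x‖ ≤ (1 + |R| ^ 4) * V₀ := by
    intro x
    by_cases hx : x ∈ ball (0 : Space) R
    · have hx1 : ‖x‖ ≤ |R| := ((mem_ball_zero_iff.1 hx).trans_le (le_abs_self R)).le
      have h4 : ‖x‖ ^ 4 ≤ |R| ^ 4 := pow_le_pow_left₀ (norm_nonneg x) hx1 4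
      rw [hv, indicator_of_mem hx, Real.norm_of_nonneg (by positivity)]
      gcongr
    · rw [hv, indicator_of_notMem hx, mul_zero, norm_zero]
      positivity
  refine ⟨hv_nonneg, ?_, ?_, ?_⟩
  · intro x y hxy
    simp only [hv, indicator, mem_ball_zero_iff, hxy]
  · exact memLp_one_iff_integrable.mp
      (hf_supp.memLp_of_bound hf_meas _ (Eventually.of_forall hf_bound))
  · exact hf_supp.memLp_of_bound hf_meas _ (Eventually.of_forall hf_bound)

/-! ## The density function `ρ(e) = sSup (solutionDensities v e)` -/

/-- Solution densities at energy `e > 0` are positive (`v ≥ 0`).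
[cite: CarlenJauslinLieb2020, (1.2)] -/
theorem pos_of_mem_solutionDensities {v : Space → ℝ} (hv0 : ∀ x, 0 ≤ v x) {e : ℝ} (he : 0 < e)
    {ρ : ℝ} (hρ : ρ ∈ solutionDensities v e) : 0 < ρ := by
  obtain ⟨u, hu⟩ := hρ
  exact hu.density_pos hv0 he

/-- `0 ≤ ρ(e)` for `e > 0`, `v ≥ 0` (all solution densities are positive; the junk value of
`sSup` is `0`). [folklore] -/
theorem densityFn_nonneg {v : Space → ℝ} (hv0 : ∀ x, 0 ≤ v x) {e : ℝ} (he : 0 < e) :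
    0 ≤ densityFn v e :=
  Real.sSup_nonneg fun _ hρ => (pos_of_mem_solutionDensities hv0 he hρ).le

/-- If every solution density at energy `e` is at most `b ≥ 0`, then `ρ(e) ≤ b`. [folklore] -/
theorem densityFn_le_of_forall_le {v : Space → ℝ} {e b : ℝ} (hb : 0 ≤ b)
    (h : ∀ ρ ∈ solutionDensities v e, ρ ≤ b) : densityFn v e ≤ b := by
  unfold densityFn
  rcases (solutionDensities v e).eq_empty_or_nonempty with h0 | hne
  · rw [h0, Real.sSup_empty]; exact hb
  · exact csSup_le hne h

/-- If `ρ(e) > 0` then the simple equation has a solution at energy `e` (otherwise the set of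
solution densities is empty and `sSup ∅ = 0`). [folklore] -/
theorem exists_isSolution_of_densityFn_pos {v : Space → ℝ} {e : ℝ} (h : 0 < densityFn v e) :
    ∃ ρ u, IsSolution v ρ e u := by
  by_contra hne
  push Not at hne
  have h0 : solutionDensities v e = ∅ :=
    Set.not_nonempty_iff_eq_empty.1 fun ⟨ρ, u, hu⟩ => hne ρ u hu
  unfold densityFn at h
  rw [h0, Real.sSup_empty] at h
  exact lt_irrefl _ h

/-- A solution density is at most `ρ(e)` as soon as the solution densities at `e` are bounded
above. [folklore] -/
theorem le_densityFn_of_isSolution {v : Space → ℝ} {ρ e b : ℝ} {u : Space → ℝ}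
    (hu : IsSolution v ρ e u) (hbdd : ∀ ρ' ∈ solutionDensities v e, ρ' ≤ b) :
    ρ ≤ densityFn v e :=
  le_csSup ⟨b, hbdd⟩ ⟨u, hu⟩

/-- Variant of `densityFn_le_mul_of_deriv_le` with continuity assumed on `(0,E)` only: if `ρ(·)`
is continuous and differentiable on `(0,E)` with `ρ′ ≤ C` there (`C ≥ 0`) and `ρ(0⁺) = 0`, then
`ρ(e) ≤ Ce` on `(0,E)` (mean value inequality on `[ε,e]`, `ε → 0⁺`). [folklore] -/
theorem densityFn_le_mul_of_deriv_le' {v : Space → ℝ} {C E : ℝ}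
    (hcont : ContinuousOn (densityFn v) (Ioo 0 E)) (hzero : Tendsto (densityFn v) (𝓝[>] 0) (𝓝 0))
    (hdiff : DifferentiableOn ℝ (densityFn v) (Ioo 0 E))
    (hderiv : ∀ e ∈ Ioo 0 E, deriv (densityFn v) e ≤ C) (hC : 0 ≤ C) {e : ℝ}
    (he : e ∈ Ioo 0 E) : densityFn v e ≤ C * e := by
  have hmvt : ∀ ε ∈ Ioo 0 e, densityFn v e - densityFn v ε ≤ C * (e - ε) := by
    intro ε hε
    have hd' : DifferentiableOn ℝ (densityFn v) (interior (Ioo 0 E)) := by rwa [interior_Ioo]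
    have hle : ∀ x ∈ interior (Ioo 0 E), deriv (densityFn v) x ≤ C := by
      rw [interior_Ioo]; exact hderiv
    exact (convex_Ioo 0 E).image_sub_le_mul_sub_of_deriv_le hcont hd' hle ε
      ⟨hε.1, hε.2.trans he.2⟩ e he hε.2.le
  have hev : ∀ᶠ ε in 𝓝[>] (0 : ℝ), densityFn v e - C * e ≤ densityFn v ε := by
    filter_upwards [Ioo_mem_nhdsGT he.1] with ε hε
    have h1 := hmvt ε hε
    have h2 : 0 ≤ C * ε := mul_nonneg hC hε.1.le
    linarith
  have hlim := le_of_tendsto_of_tendsto tendsto_const_nhds hzero hev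
  linarith

/-! ## CJL-II Theorem 3 as printed is false -/

/-- **CJL-II Theorem 3 as printed is false**, unconditionally — no appeal to CJL-I Theorems 1–2
(compare `not_CarlenJauslinLieb2021_thm3` of `LiebSimpleEquationErratum.lean`, which assumes them
and refutes the very same explicit statement: "For `e < e⋆ := √2π³/‖v‖₁²` and for
`e > 2³‖v‖₂⁴/π⁴`, `ρ(e)` is strictly monotone increasing in `e`, and in these intervals `ρ(e)` is
continuously differentiable. […] Moreover, for `e < e⋆` we have `ρ′ ≤ 16/‖v‖₁`", rendered with
`ρ(·) = densityFn v`, `e⋆ = eStar v`, `2³‖v‖₂⁴/π⁴ = eHigh v`, `e > 0`, `v ≢ 0`; formerly the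
named fact `CarlenJauslinLieb2021_thm3`, retired once refuted).
Witness: the square well `v = 30·𝟙_{|x|<1}` (`‖v‖₁ = 40π`, `e⋆ = √2π/1600 < 1/100`). If Theorem 3
held, then on `(0,e⋆)`: (i) strict monotonicity and `ρ ≥ 0` give `ρ(e) > 0`, so (under the `sSup`
rendering of `ρ(·)`) a solution exists at every such `e` and its density is `≤ ρ(e)`; (ii) every
solution density at energy `e` is `≤ Ke` (`density_mul_le_of_squareWell`), so `ρ(0⁺) = 0`, and
with `ρ ∈ C¹`, `ρ′ ≤ 16/‖v‖₁` this gives `ρ(e) ≤ 16e/‖v‖₁ = 2e/(5π)`; (iii) every solution at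
energy `e` has `2e·e^{−2√e} ≤ 4πρ` (`two_mul_energy_mul_exp_le`). At `e₀ = e⋆/2`:
`2e₀(1 − 2√e₀) ≤ 4π · 2e₀/(5π) = (8/5)e₀`, i.e. `2√e₀ ≥ 1/5`, contradicting `e₀ < 1/100`.
The located defect in print is the one recorded in `LiebSimpleEquationErratum.lean` (the bound
`ρ′ ≤ 16/‖v‖₁` rests on the false upper half `ρ ≤ 4e/‖v‖₁` of "(1.21) of [CJL20]").
[cite: CarlenJauslinLieb2021, Theorem 3 and its proof (§3)] -/
theorem not_CarlenJauslinLieb2021_thm3_unconditional :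
    ¬ ∀ v : Space → ℝ, IsWeightedPotential v → 0 < ∫ x, v x →
        StrictMonoOn (densityFn v) (Ioo 0 (eStar v)) ∧
        StrictMonoOn (densityFn v) (Ioi (max 0 (eHigh v))) ∧
        ContDiffOn ℝ 1 (densityFn v) (Ioo 0 (eStar v)) ∧
        ContDiffOn ℝ 1 (densityFn v) (Ioi (max 0 (eHigh v))) ∧
        ∀ e ∈ Ioo 0 (eStar v), deriv (densityFn v) e ≤ 16 / ∫ x, v x := by
  intro h3
  set v : Space → ℝ := (ball (0 : Space) 1).indicator fun _ => (30 : ℝ) with hv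
  have hv0 : ∀ x, 0 ≤ v x := fun x => indicator_nonneg (fun _ _ => by norm_num) x
  have hvb : ∀ x, v x ≤ 30 := fun x =>
    indicator_le_self' (fun _ _ => by norm_num) x |>.trans le_rfl
  have hvR : ∀ x, 1 ≤ ‖x‖ → v x = 0 := fun x hx =>
    indicator_of_notMem (by rwa [mem_ball_zero_iff, not_lt]) _
  have hvin : ∀ x, ‖x‖ < 1 → v x = 30 := fun x hx =>
    indicator_of_mem (mem_ball_zero_iff.2 hx) _
  have hW : IsWeightedPotential v := isWeightedPotential_indicator_ball 1 (by norm_num)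
  have hvi : Integrable v := hW.integrable_self
  have hint : ∫ x, v x = 40 * Real.pi := by
    rw [hv, integral_indicator_const (30 : ℝ) measurableSet_ball, measureReal_def,
      EuclideanSpace.volume_ball_fin_three, ENNReal.toReal_mul, ← ENNReal.ofReal_pow zero_le_one,
      one_pow, ENNReal.toReal_ofReal zero_le_one,
      ENNReal.toReal_ofReal (by positivity : (0 : ℝ) ≤ Real.pi * 4 / 3), smul_eq_mul]
    ring
  have hpos : 0 < ∫ x, v x := by rw [hint]; positivity
  obtain ⟨hmono, -, hC1, -, hder⟩ := h3 v hW hpos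
  -- (ii) the a priori bound `ρ ≤ K e` on solution densities, hence `ρ(0⁺) = 0`
  set vol : ℝ := (volume (ball (0 : Space) 1)).toReal with hvol_def
  have hvol : 0 < vol :=
    ENNReal.toReal_pos (measure_ball_pos volume (0 : Space) one_pos).ne' measure_ball_lt_top.ne
  set M₀ : ℝ := ∫ t, (ball (0 : Space) (2 * 1)).indicator (yukawa 0) t with hM₀
  have hM0 : 0 ≤ M₀ := integral_nonneg fun t => indicator_nonneg (fun y _ => yukawa_nonneg 0 y) t
  set K : ℝ := 4 * (1 + 30 * M₀) / (30 * vol) with hK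
  have hK0 : 0 ≤ K := by positivity
  have hsolK : ∀ e, 0 < e → ∀ ρ ∈ solutionDensities v e, ρ ≤ K * e := by
    rintro e he ρ ⟨u, hu⟩
    have h := hu.density_mul_le_of_squareWell (R := 1) (by norm_num : (0 : ℝ) < 30) hv0 hvb hvR
      hvin hvi he
    calc ρ = ρ * (30 * vol) / (30 * vol) := by field_simp
      _ ≤ 4 * e * (1 + 30 * M₀) / (30 * vol) := by gcongr
      _ = K * e := by rw [hK]; ring
  have hρK : ∀ e, 0 < e → densityFn v e ≤ K * e := fun e he =>
    densityFn_le_of_forall_le (by positivity) (hsolK e he)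
  have hρnn : ∀ e, 0 < e → 0 ≤ densityFn v e := fun e he => densityFn_nonneg hv0 he
  have hzero : Tendsto (densityFn v) (𝓝[>] 0) (𝓝 0) := by
    have h1 : Tendsto (fun e : ℝ => K * e) (𝓝[>] 0) (𝓝 0) := by
      have h : Tendsto (fun e : ℝ => K * e) (𝓝 0) (𝓝 0) :=
        (continuous_const.mul continuous_id).tendsto' 0 0 (by simp)
      exact h.mono_left nhdsWithin_le_nhds
    refine tendsto_of_tendsto_of_tendsto_of_le_of_le' tendsto_const_nhds h1 ?_ ?_
    · filter_upwards [self_mem_nhdsWithin] with e he using hρnn e he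
    · filter_upwards [self_mem_nhdsWithin] with e he using hρK e he
  -- `ρ(e) ≤ 16e/‖v‖₁` on `(0, e⋆)`
  set I : ℝ := ∫ x, v x with hI
  have hρle : ∀ e ∈ Ioo 0 (eStar v), densityFn v e ≤ 16 / I * e := fun e he =>
    densityFn_le_mul_of_deriv_le' hC1.continuousOn hzero (hC1.differentiableOn one_ne_zero) hder
      (by positivity) he
  -- `e⋆ = √2π/1600 ≤ 1/200`
  have heS : 0 < eStar v := eStar_pos hpos
  have heS' : eStar v ≤ 1 / 200 := by
    show Real.sqrt 2 * Real.pi ^ 3 / I ^ 2 ≤ 1 / 200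
    have h2 : Real.sqrt 2 ≤ 2 := Real.sqrt_le_iff.2 ⟨by norm_num, by norm_num⟩
    have hπ := Real.pi_le_four
    have hπ0 := Real.pi_pos
    have h3 : Real.sqrt 2 * Real.pi ≤ 2 * 4 := mul_le_mul h2 hπ hπ0.le (by norm_num)
    have h4 : Real.sqrt 2 * Real.pi ^ 3 ≤ 8 * Real.pi ^ 2 := by nlinarith [sq_nonneg Real.pi]
    rw [hint, div_le_iff₀ (by positivity)]
    nlinarith [h4]
  -- (i) a solution at `e₀ = e⋆/2` with density `≤ ρ(e₀)`
  set e₀ : ℝ := eStar v / 2 with he₀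
  have he₀m : e₀ ∈ Ioo 0 (eStar v) := ⟨by positivity, by linarith⟩
  have he₁m : e₀ / 2 ∈ Ioo 0 (eStar v) := ⟨by positivity, by linarith⟩
  have hlt : densityFn v (e₀ / 2) < densityFn v e₀ := hmono he₁m he₀m (by linarith [he₀m.1])
  have hposρ : 0 < densityFn v e₀ := (hρnn _ he₁m.1).trans_lt hlt
  obtain ⟨ρ₁, u₁, hu₁⟩ := exists_isSolution_of_densityFn_pos hposρ
  have hρ₁le : ρ₁ ≤ densityFn v e₀ := le_densityFn_of_isSolution hu₁ (hsolK e₀ he₀m.1)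
  have hup : densityFn v e₀ ≤ 16 / I * e₀ := hρle e₀ he₀m
  -- (iii) the lower bound at `e₀`
  have hlow := hu₁.two_mul_energy_mul_exp_le one_pos hv0 hvb hvR hvi he₀m.1
  -- numerics
  have he₀small : e₀ < 1 / 100 := by
    have : e₀ ≤ 1 / 400 := by rw [he₀]; linarith
    linarith
  have hsq : Real.sqrt (4 * e₀) < 1 / 5 := by
    rw [Real.sqrt_lt' (by norm_num)]
    nlinarith
  have hexp : 1 - Real.sqrt (4 * e₀) ≤ Real.exp (-(Real.sqrt (4 * e₀) * 1)) := by
    have := Real.add_one_le_exp (-(Real.sqrt (4 * e₀) * 1))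
    linarith
  have hfin : 2 * e₀ * (1 - Real.sqrt (4 * e₀)) ≤ 8 / 5 * e₀ := by
    calc 2 * e₀ * (1 - Real.sqrt (4 * e₀)) ≤ 2 * e₀ * Real.exp (-(Real.sqrt (4 * e₀) * 1)) :=
          mul_le_mul_of_nonneg_left hexp (by linarith [he₀m.1])
      _ ≤ 4 * Real.pi * 1 * ρ₁ := hlow
      _ ≤ 4 * Real.pi * 1 * (16 / I * e₀) := by gcongr; exact hρ₁le.trans hup
      _ = 8 / 5 * e₀ := by rw [hint]; field_simp; ring
  nlinarith [he₀m.1, hsq, hfin]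

end LiebSimpleEquation

end Literature.MathematicalPhysics.QuantumManyBody

end
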